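import Literature.AlgebraicGeometry.KTheory.EulerCharResolutionIndependence
import Literature.AlgebraicGeometry.KTheory.EulerCharOfDerivedIso
import Literature.AlgebraicGeometry.Modules.BoundedCoherentVBModelsProjective
import Mathlib.Algebra.Homology.HomotopyCategory.ShortExact
import Mathlib.Algebra.Homology.DerivedCategory.Basic
import HarnessLib

/-!
# Additivity of `[F] = Σ(−1)ⁱ[ℰ_i] ∈ K₀(X)` on short exact sequences of coherent sheaves — Hartshorne III Ex. 6.9 (b),
# clause 2 (Fulton B.8.3 (iii)–(iv)), PROVED from the existence of finite locally free resolutions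

Layer `Literature/AlgebraicGeometry/KTheory` (0 named facts, no definitions, no instances). Sequel to
`KTheory/EulerCharResolutionIndependence` (clause 1 of Hartshorne III Ex. 6.9 (b): `KZero.ofCoh F R` does not depend on the
strictly perfect resolution `R`, under `hres : ∀ G, Coh G → Nonempty (StrictlyPerfectResolution G)`). Here, under the SAME
hypothesis `hres` on a locally noetherian scheme `X`:

* §1 **`KZero.ofCoh_shortExact_of_hres`** — for a short exact sequence `0 → F₁ → F₂ → F₃ → 0` of coherent `𝒪_X`-modules and ANY
  strictly perfect resolutions `Rᵢ` of the `Fᵢ`, `[F₂] = [F₁] + [F₃]` in `K₀(X)`, i.e.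
  `KZero.ofCoh F₂ R₂ = KZero.ofCoh F₁ R₁ + KZero.ofCoh F₃ R₃`.

  Proof (by the tree's derived-category invariance of `χ`, no horseshoe): the chain map
  `π := (R₁.ε ≫ f[0], R₂.ε) : R₁.P ⊞ R₂.P ⟶ F₂[0]` is an epimorphism in degree `0`, so the ADAPTED RESOLUTION
  (`KTheory/AdaptedResolution.exists_adaptedResolution`, Fulton B.8.3 (v)) is a vector-bundle resolution `ε₂ : P₂ ⟶ F₂[0]` with a
  chain map `j : R₁.P ⊞ R₂.P ⟶ P₂` over `F₂[0]`; `i := inl ≫ j : R₁.P ⟶ P₂` LIFTS `f` (`i ≫ ε₂ = R₁.ε ≫ f[0]`). Then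
  `χ(Cone i) = χ(P₂) − χ(R₁.P)` (`eulerChar_mappingCone`), `χ(P₂) = χ(R₂.P)` (resolution independence), and
  `χ(Cone i) = χ(R₃.P)` because `Cone i ≅ Cone (f[0]) ≅ F₃[0] ≅ R₃.P` in `D(Mod 𝒪_X)` — the morphism of mapping-cone
  triangles induced by the quasi-isomorphisms `(R₁.ε, ε₂)` is an isomorphism on cones (Mathlib
  `CochainComplex.mappingCone.triangleMap`, `DerivedCategory.mappingCone_triangle_distinguished`, `Pretriangulated.isIso₃_of_isIso₁₂`),
  the cone of the monomorphism `f[0]` is quasi-isomorphic to `F₃[0]` (`CochainComplex.mappingCone.quasiIso_descShortComplex`), and `χ`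
  of bounded vector-bundle complexes is a `D(Mod 𝒪_X)`-isomorphism invariant (`IsBoundedVBComplex.eulerChar_eq_of_nonempty_iso_Q`).
* §2 the hypothesis `hres` DISCHARGED: **`IsSmoothProjective.ofCoh_shortExact`** on every smooth projective variety over a field
  (`Modules/BoundedCoherentVBModelsProjective.IsSmoothProjective.nonempty_strictlyPerfectResolution_of_coh`), and
  `IsProjectiveOver.ofCoh_shortExact_of_isRegular` on projective regular `k`-schemes of bounded dimension.

This is the CONTENT of the second clause of the displayed fact
`KTheory/CoherentEulerCharacteristic.Hartshorne1977_eulerChar_resolution_shortExact` with `hres` in place of its hypotheses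
«noetherian, integral, separated, regular» (under which `hres` is Hartshorne III Ex. 6.8 + 6.9 (a), Kleiman's resolution property —
not in the tree); that fact is neither restated nor discharged here, and no consumer of it is touched.

## References

* R. Hartshorne, *Algebraic Geometry*, GTM 52 (1977), III Ex. 6.9 (b) (p. 239). [Hartshorne1977]
* W. Fulton, *Intersection Theory*, 2nd ed. (1998), App. B.8.3 (iii)–(v), §15.1. [Fulton1998]
* A. Borel, J.-P. Serre, *Le théorème de Riemann–Roch*, Bull. SMF 86 (1958), §4 Lemmes 11–12. [BorelSerre1958]
* P. Berthelot, A. Grothendieck, L. Illusie, *SGA 6*, Exp. IV §2 (`K•(X) → K•(X)`). [SGA6]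
* M. Schlichting, *Higher algebraic K-theory*, LNM 2008 (2011), §3.1.3–3.1.4. [Schlichting2011HigherKTheory]
-/

noncomputable section

universe w u

open CategoryTheory CategoryTheory.Limits CategoryTheory.Pretriangulated AlgebraicGeometry HomologicalComplex

namespace Literature.AlgebraicGeometry.KTheory

open Literature.AlgebraicGeometry.Modules Literature.AlgebraicGeometry.Morphisms Literature.AlgebraicGeometry.Motives
  Literature.AlgebraicGeometry.KTheory.Adapted

variable {X : Scheme.{u}}

/-! ### §1 Additivity under `hres` -/

section Additivity

variable [IsLocallyNoetherian X]

omit [IsLocallyNoetherian X] in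
/-- **The cone of a lift of `f : F₁ ↪ F₂` between vector-bundle resolutions is a vector-bundle model of `F₃ = F₂ ∕ F₁`.** For a short
exact sequence `S : 0 → F₁ → F₂ → F₃ → 0` of `𝒪_X`-modules, complexes `P₁`, `P₂` with quasi-isomorphisms `ε₁ : P₁ ⟶ F₁[0]`,
`ε₂ : P₂ ⟶ F₂[0]` and a chain map `i : P₁ ⟶ P₂` with `i ≫ ε₂ = ε₁ ≫ f[0]`, the class of `Cone i` in `D(Mod 𝒪_X)` is that of
`F₃[0]`: the morphism of mapping-cone triangles induced by `(ε₁, ε₂)` is an isomorphism on the third vertices (five lemma in the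
derived category), and `Cone (f[0]) ⟶ F₃[0]` is a quasi-isomorphism. [cite: Schlichting2011HigherKTheory, §3.1.3]
[cite: StacksProject, Tag 014A and Tag 08J5] -/
theorem nonempty_Q_mappingCone_iso_Q_single [HasDerivedCategory.{w} X.Modules] {S : ShortComplex X.Modules}
    (hS : S.ShortExact) {P₁ P₂ : CochainComplex X.Modules ℤ}
    (ε₁ : P₁ ⟶ (HomologicalComplex.single X.Modules (ComplexShape.up ℤ) 0).obj S.X₁)
    (ε₂ : P₂ ⟶ (HomologicalComplex.single X.Modules (ComplexShape.up ℤ) 0).obj S.X₂) [QuasiIso ε₁] [QuasiIso ε₂]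
    (i : P₁ ⟶ P₂) (hi : i ≫ ε₂ = ε₁ ≫ (HomologicalComplex.single X.Modules (ComplexShape.up ℤ) 0).map S.f) :
    Nonempty (DerivedCategory.Q.obj (CochainComplex.mappingCone i) ≅
      DerivedCategory.Q.obj ((HomologicalComplex.single X.Modules (ComplexShape.up ℤ) 0).obj S.X₃)) := by
  -- the short exact sequence of complexes `0 → F₁[0] → F₂[0] → F₃[0] → 0`
  let S' : ShortComplex (CochainComplex X.Modules ℤ) :=
    S.map (HomologicalComplex.single X.Modules (ComplexShape.up ℤ) 0)
  have hS' : S'.ShortExact := hS.map_of_exact (HomologicalComplex.single X.Modules (ComplexShape.up ℤ) 0)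
  -- the morphism of mapping-cone triangles induced by `(ε₁, ε₂)`, an isomorphism on cones in `D(Mod 𝒪_X)`
  let τ := CochainComplex.mappingCone.triangleMap i S'.f ε₁ ε₂ hi
  haveI h₁ : IsIso (DerivedCategory.Q.mapTriangle.map τ).hom₁ :=
    (DerivedCategory.isIso_Q_map_iff_quasiIso _ ε₁).2 inferInstance
  haveI h₂ : IsIso (DerivedCategory.Q.mapTriangle.map τ).hom₂ :=
    (DerivedCategory.isIso_Q_map_iff_quasiIso _ ε₂).2 inferInstance
  haveI h₃ : IsIso (DerivedCategory.Q.mapTriangle.map τ).hom₃ :=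
    isIso₃_of_isIso₁₂ _ (DerivedCategory.mappingCone_triangle_distinguished i)
      (DerivedCategory.mappingCone_triangle_distinguished S'.f) h₁ h₂
  -- `Cone (f[0]) ⟶ F₃[0]` is a quasi-isomorphism
  haveI : QuasiIso (CochainComplex.mappingCone.descShortComplex S') :=
    CochainComplex.mappingCone.quasiIso_descShortComplex hS'
  have hq : IsIso (DerivedCategory.Q.map (CochainComplex.mappingCone.descShortComplex S')) :=
    (DerivedCategory.isIso_Q_map_iff_quasiIso _ _).2 inferInstance
  exact ⟨@asIso _ _ _ _ _ h₃ ≪≫ @asIso _ _ _ _ _ hq⟩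

/-- **Hartshorne III Ex. 6.9 (b), clause 2 ∕ Fulton B.8.3 (iii)–(iv): `[F₂] = [F₁] + [F₃]` in `K₀(X)`** for a short exact sequence
`0 → F₁ → F₂ → F₃ → 0` of coherent `𝒪_X`-modules on a locally noetherian scheme on which every coherent module has a finite locally
free resolution (`hres`), computed on ANY strictly perfect resolutions `R₁`, `R₂`, `R₃`. Proof: `i := inl ≫ j : R₁.P ⟶ P₂` for the
adapted resolution `P₂ ⟶ F₂[0]` of `(R₁.ε ≫ f[0], R₂.ε) : R₁.P ⊞ R₂.P ↠ F₂[0]` lifts `f`; `χ(Cone i) = χ(P₂) − χ(R₁.P)`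
(`eulerChar_mappingCone`), `χ(P₂) = χ(R₂.P)` (`IsBoundedVBComplex.eulerChar_eq_of_quasiIso_toSingle`), and `χ(Cone i) = χ(R₃.P)` by
`nonempty_Q_mappingCone_iso_Q_single` and the `D(Mod 𝒪_X)`-invariance `IsBoundedVBComplex.eulerChar_eq_of_nonempty_iso_Q`.
[cite: Hartshorne1977, III Ex. 6.9 (b) (p. 239)] [cite: Fulton1998, App. B.8.3 (iii)–(v)] [cite: BorelSerre1958, §4 Lemme 12] -/
theorem KZero.ofCoh_shortExact_of_hres (hres : ∀ G : X.Modules, Coh G → Nonempty (StrictlyPerfectResolution G))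
    {S : ShortComplex X.Modules} (hS : S.ShortExact) (h₂ : Coh S.X₂)
    (R₁ : StrictlyPerfectResolution S.X₁) (R₂ : StrictlyPerfectResolution S.X₂) (R₃ : StrictlyPerfectResolution S.X₃) :
    KZero.ofCoh S.X₂ R₂ = KZero.ofCoh S.X₁ R₁ + KZero.ofCoh S.X₃ R₃ := by
  letI := HasDerivedCategory.standard X.Modules
  -- `(R₁.ε ≫ f[0], R₂.ε) : R₁.P ⊞ R₂.P ↠ F₂[0]`, an epimorphism in degree `0`
  let sF := HomologicalComplex.single X.Modules (ComplexShape.up ℤ) 0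
  let ε₁ : R₁.P ⟶ sF.obj S.X₁ := R₁.ε
  let ε₂' : R₂.P ⟶ sF.obj S.X₂ := R₂.ε
  let ε₃ : R₃.P ⟶ sF.obj S.X₃ := R₃.ε
  haveI : QuasiIso ε₁ := R₁.quasiIso
  haveI : QuasiIso ε₂' := R₂.quasiIso
  haveI : QuasiIso ε₃ := R₃.quasiIso
  haveI := IsBoundedVBComplex.isStrictlyLE_biprod (K := R₁.P) (L := R₂.P) 0
  let π : R₁.P ⊞ R₂.P ⟶ sF.obj S.X₂ := biprod.desc (ε₁ ≫ sF.map S.f) ε₂'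
  haveI hπ : Epi (π.f 0) := by
    haveI := IsBoundedVBComplex.epi_f_of_quasiIso_toSingle ε₂' R₂.quasiIso
    haveI : Epi ((biprod.inr : R₂.P ⟶ R₁.P ⊞ R₂.P).f 0 ≫ π.f 0) := by
      rw [← HomologicalComplex.comp_f, biprod.inr_desc]; infer_instance
    exact epi_of_epi ((biprod.inr : R₂.P ⟶ R₁.P ⊞ R₂.P).f 0) _
  -- the adapted resolution `ε₂ : P₂ ⟶ F₂[0]` with `j : R₁.P ⊞ R₂.P ⟶ P₂` over `F₂[0]`
  obtain ⟨P₂, j, ε₂, hP₂, hLE, hjε, hε₂⟩ :=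
    exists_adaptedResolution hres (R₁.isBoundedVB.biprod R₂.isBoundedVB) h₂ π hπ
  haveI := hLE
  haveI := hε₂
  -- `χ(P₂) = χ(R₂.P)`
  have eP₂ : eulerChar P₂ hP₂.isFiniteLocallyFree = KZero.ofCoh S.X₂ R₂ :=
    IsBoundedVBComplex.eulerChar_eq_of_quasiIso_toSingle hres h₂ hP₂ R₂.isBoundedVB ε₂ ε₂' hε₂ R₂.quasiIso
  -- `i := inl ≫ j` lifts `f`
  let i : R₁.P ⟶ P₂ := biprod.inl ≫ j
  have hi : i ≫ ε₂ = ε₁ ≫ sF.map S.f := by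
    simp only [i, Category.assoc, hjε, π, biprod.inl_desc]
  -- `χ(Cone i) = χ(P₂) − χ(R₁.P)` and `χ(Cone i) = χ(R₃.P)`
  have hcone := eulerChar_mappingCone R₁.isBoundedVB hP₂ i
  obtain ⟨e⟩ := nonempty_Q_mappingCone_iso_Q_single hS ε₁ ε₂ i hi
  haveI : IsIso (DerivedCategory.Q.map ε₃) := (DerivedCategory.isIso_Q_map_iff_quasiIso _ ε₃).2 inferInstance
  have h₃' : eulerChar (CochainComplex.mappingCone i) (R₁.isBoundedVB.mappingCone hP₂ i).isFiniteLocallyFree =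
      KZero.ofCoh S.X₃ R₃ :=
    (R₁.isBoundedVB.mappingCone hP₂ i).eulerChar_eq_of_nonempty_iso_Q hres R₃.isBoundedVB
      ⟨e ≪≫ (asIso (DerivedCategory.Q.map ε₃)).symm⟩
  -- assemble
  rw [← eP₂, ← h₃', hcone, KZero.ofCoh_def]
  abel

/-- The same in the binder shape of the displayed fact `Hartshorne1977_eulerChar_resolution_shortExact` (coherence witnesses of all
three sheaves; those of `F₁` and `F₃` are not needed by the proof — only `hres` and the given resolutions are).
[cite: Hartshorne1977, III Ex. 6.9 (b) (p. 239)] -/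
theorem KZero.ofCoh_shortExact_of_hres' (hres : ∀ G : X.Modules, Coh G → Nonempty (StrictlyPerfectResolution G))
    {S : ShortComplex X.Modules} (hS : S.ShortExact) (_h₁ : Coh S.X₁) (h₂ : Coh S.X₂) (_h₃ : Coh S.X₃)
    (R₁ : StrictlyPerfectResolution S.X₁) (R₂ : StrictlyPerfectResolution S.X₂) (R₃ : StrictlyPerfectResolution S.X₃) :
    KZero.ofCoh S.X₂ R₂ = KZero.ofCoh S.X₁ R₁ + KZero.ofCoh S.X₃ R₃ :=
  KZero.ofCoh_shortExact_of_hres hres hS h₂ R₁ R₂ R₃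

end Additivity

/-! ### §2 `hres` discharged: smooth projective varieties and projective regular schemes over a field -/

section Projective

variable {k : Type u} [Field k] {n : ℕ} {Y : SchemeOver k}

/-- **`[F₂] = [F₁] + [F₃]` in `K₀(Y)` on a projective regular `k`-scheme of bounded dimension**, on any strictly perfect resolutions
(`hres` = `IsProjectiveOver.nonempty_strictlyPerfectResolution_of_coh_of_isRegular`). [cite: Hartshorne1977, III Ex. 6.9 (b) (p. 239)]
[cite: Fulton1998, App. B.8.3 (iii)–(v)] -/
theorem IsProjectiveOver.ofCoh_shortExact_of_isRegular (hY : IsProjectiveOver Y) (hreg : Resolution.Scheme.IsRegular Y.left)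
    {d : ℕ} (hdim : ∀ y : Y.left, ringKrullDim (Y.left.presheaf.stalk y) ≤ d)
    {S : ShortComplex Y.left.Modules} (hS : S.ShortExact) (h₂ : Coh S.X₂)
    (R₁ : StrictlyPerfectResolution S.X₁) (R₂ : StrictlyPerfectResolution S.X₂) (R₃ : StrictlyPerfectResolution S.X₃) :
    KZero.ofCoh S.X₂ R₂ = KZero.ofCoh S.X₁ R₁ + KZero.ofCoh S.X₃ R₃ := by
  haveI : IsProper Y.hom := hY.isProper
  haveI : IsLocallyNoetherian Y.left := LocallyOfFiniteType.isLocallyNoetherian Y.hom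
  exact KZero.ofCoh_shortExact_of_hres
    (fun G hG => Modules.IsProjectiveOver.nonempty_strictlyPerfectResolution_of_coh_of_isRegular hY hreg hdim hG)
    hS h₂ R₁ R₂ R₃

/-- **Hartshorne III Ex. 6.9 (b), clause 2, on a smooth projective variety over a field, hypothesis-free**: for a short exact sequence
`0 → F₁ → F₂ → F₃ → 0` of coherent `𝒪_Y`-modules and any strictly perfect resolutions, `[F₂] = [F₁] + [F₃]` in `K₀(Y)`
(`hres` = `IsSmoothProjective.nonempty_strictlyPerfectResolution_of_coh`). [cite: Hartshorne1977, III Ex. 6.9 (b) (p. 239)]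
[cite: Fulton1998, App. B.8.3 (iii)–(v) and §15.1] -/
theorem IsSmoothProjective.ofCoh_shortExact (hY : IsSmoothProjective n Y)
    {S : ShortComplex Y.left.Modules} (hS : S.ShortExact) (h₂ : Coh S.X₂)
    (R₁ : StrictlyPerfectResolution S.X₁) (R₂ : StrictlyPerfectResolution S.X₂) (R₃ : StrictlyPerfectResolution S.X₃) :
    KZero.ofCoh S.X₂ R₂ = KZero.ofCoh S.X₁ R₁ + KZero.ofCoh S.X₃ R₃ := by
  haveI : IsProper Y.hom := hY.isProjectiveOver.isProper
  haveI : IsLocallyNoetherian Y.left := LocallyOfFiniteType.isLocallyNoetherian Y.hom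
  exact KZero.ofCoh_shortExact_of_hres
    (fun G hG => Modules.IsSmoothProjective.nonempty_strictlyPerfectResolution_of_coh hY hG) hS h₂ R₁ R₂ R₃

/-- Resolution independence on a smooth projective variety, hypothesis-free (clause 1 of Hartshorne III Ex. 6.9 (b):
`KZero.ofCoh_eq_of_hres` with `hres` discharged). [cite: Hartshorne1977, III Ex. 6.9 (b) (p. 239)] [cite: Fulton1998, App. B.8.3 (v)] -/
theorem IsSmoothProjective.ofCoh_eq (hY : IsSmoothProjective n Y) {F : Y.left.Modules} (hF : Coh F)
    (R R' : StrictlyPerfectResolution F) : KZero.ofCoh F R = KZero.ofCoh F R' := by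
  haveI : IsProper Y.hom := hY.isProjectiveOver.isProper
  haveI : IsLocallyNoetherian Y.left := LocallyOfFiniteType.isLocallyNoetherian Y.hom
  exact KZero.ofCoh_eq_of_hres
    (fun G hG => Modules.IsSmoothProjective.nonempty_strictlyPerfectResolution_of_coh hY hG) hF R R'

end Projective

end Literature.AlgebraicGeometry.KTheory

end
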